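import Summits.BirchSwinnertonDyer.BirchSwinnertonDyer.Theorems.QuadraticBranchSignedControlPlusEtaNonsurjThetaFunctionalEquationNormCoordinateIdeal
import Summits.BirchSwinnertonDyer.BirchSwinnertonDyer.Theorems.SignedLowerHalvesSprungLowerDivisibilityAtThreeIotaRigidity
import HarnessLib

/-!
# Route `QuadraticBranchSignedControl` (rung K8, cell `bsd-potss`), residual crux `PlusEtaMainConjectureNonsurj`
# (stmt-BirchSwinnertonDyer-19606): THE FUNCTIONAL EQUATION ON THE QUADRATIC BRANCH, XXXII — DIVISIBILITY IN THE NORM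
# COORDINATE: **`f₁ ∣ f₂` in `Λ` ⟺ `μ₁ ≤ μ₂ ∧ P₁ ∣ P₂` in `ℤ_p[T]`**, **`H₁(Z) ∣ H₂(Z)` in `Λ` ⟺ `H₁ ∣ H₂` in `ℤ_p[Z]`**, and for two
# norm forms `f_i = p^{m_i}·T^{r_i}(1+T)^{k_i}H_i(Z)·U_i`: **`f₁ ∣ f₂ ⟺ m₁ ≤ m₂ ∧ r₁ ≤ r₂ ∧ H₁ ∣ H₂`**, **`(f₁) = (f₂) ⟺ (m, r₀, H) agree**
# (seat `bsd-potss-k8eta-c2` g31; kernel, generic `Λ`-algebra, fact-free)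

WHY. Parts XXVI/XXVII put BOTH sides of the `η`-main conjecture of the crux into one normal form: every `L_p^±(V, η, X)` (analytic,
fact-free) and — granted Kim 3.11η — every generator of `Char X^ε(V/K_∞)^η` (algebraic) is `p^m · T^{r₀}(1+T)^k H(Z) · unit` with
`H ∈ ℤ_p[Z]` DISTINGUISHED of degree `k`, `Z = T + ιT = T²/(1+T)`, `r₀ = ord_T`. The crux at a row is an equality of principal ideals
`Char = (L)`; its two halves are divisibilities (Kobayashi Thm. 4.1: `pⁿL ∈ Char`; the Eisenstein inclusion `Char ⊆ (L)`). g30 listed as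
NEXT (2): «the main conjecture at a row in the norm coordinate: `(L) = Char ⟺ μ_an = μ_alg ∧ r₀,an = r₀,alg ∧ H_an = H_alg`; Kato-type
divisibility reads `H_alg ∣ H_an` in `ℤ_p[Z]`». THIS FILE proves the commutative algebra behind that dictionary, for ARBITRARY elements
of `Λ` given with Weierstrass data / norm forms (Part XXXIII applies it to the crux's objects):
* (§94) for Weierstrass data `f_i = p^{m_i}·P_i·U_i`: **`f₁ ∣ f₂ ⟺ m₁ ≤ m₂ ∧ P₁ ∣ P₂` (in `ℤ_p[T]`)**, the quotient's datum being
  `(m₂ − m₁, P₂/P₁, U₂/U₁)`; **`(f₁) = (f₂) ⟺ m₁ = m₂ ∧ P₁ = P₂`**;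
* (§95) **`H₁(Z) ∣ H₂(Z)` in `Λ` ⟺ `H₁ ∣ H₂` in `ℤ_p[Z]`** for `H₁` distinguished: the cofactor `q` is `ι`-invariant (`Λ` a domain), hence
  `q = G(Z)` by the fixed-ring theorem `Λ^ι = ℤ_p⟦Z⟧` (Part XXIII), `H₂ = H₁·G` in `Λ` by injectivity of `H ↦ H(Z)`, and divisibility by a
  distinguished polynomial in `Λ` is divisibility in the polynomial ring (`Λ/(H₁) ≅ ℤ_p[T]/(H₁)`, the tree's `ChromaticIota.dvd_of_coe_dvd_coe`);
  the constant term of a norm form: `H(0) ≠ 0` (`Z ∤ H`: the zero `T = 0` lives entirely in `r₀`);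
* (§96) for two norm forms: **`f₁ ∣ f₂ ⟺ m₁ ≤ m₂ ∧ r₁ ≤ r₂ ∧ H₁ ∣ H₂`** (`r₂ = r₁ + ord_T(f₂/f₁)` cancels the `T`-powers inside the
  domain `Λ`, no unique factorisation needed), **`f₁ ∣ pⁿ·f₂ ⟺ m₁ ≤ m₂ + n ∧ r₁ ≤ r₂ ∧ H₁ ∣ H₂`**, and
  **`(f₁) = (f₂) ⟺ m₁ = m₂ ∧ r₁ = r₂ ∧ H₁ = H₂`**.
The point for the crux (Part XXXIII): an `ι`-STABLE divisor of `L` (as `Char` is, by Kim 3.11η) is constrained to `H_alg ∣ H_an` in the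
HALF-degree ring `ℤ_p[Z]` — it can never pick one zero `c` of a `ℤ_p`-rational pair `{c, c^ι}` (P-30M's EXISTS rows) without the other.

MATHEMATICS (Washington §7.1: Weierstrass preparation and its uniqueness; `Λ` a domain). (§94) `f₂ = f₁q`, `q = p^{m_q}P_qU_q` ⟹
`p^{m₂}P₂U₂ = p^{m₁+m_q}(P₁P_q)(U₁U_q)` ⟹ `m₂ = m₁ + m_q`, `P₂ = P₁P_q` (uniqueness: `eq_of_C_pow_mul_eq` + `IsWeierstrassFactorization.elim`);
conversely `P₂ = P₁R`, `m₁ ≤ m₂` ⟹ `f₂ = f₁·p^{m₂−m₁}R U₂U₁⁻¹`; mutual divisibility of monic polynomials is equality. (§95) as above.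
(§96) `ord_T f = ord_T P = r` for a norm form (`(1+T)^kH(Z)` has order `2·ord H`, and `r = ord_T f` forces `ord H = 0`); if `f₁ ∣ f₂`:
`P₂ = P₁P_q` in `Λ`, `P_q = T^s·D` with `s = ord_T q = r₂ − r₁`, cancel `T^{r₂}`: `(1+T)^{k₂}H₂(Z) = (1+T)^{k₁}H₁(Z)·D`, so `H₁(Z) ∣ H₂(Z)`;
conversely `H₂ = H₁G` ⟹ `P₂ = P₁ · T^{r₂−r₁}(1+T)^{deg G}G(Z)`.

WHAT (20 theorems). §94 `red_coe_mul_ne_zero`, `weierstrass_ne_zero`, `mu_pfree_of_weierstrass`, `lam_of_weierstrass`, `order_of_weierstrass`,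
**`exists_weierstrass_quotient_of_dvd`**, **`weierstrass_dvd_iff`**, `weierstrass_eq_of_span_eq`, **`weierstrass_span_eq_iff`**; §95 `subst_trace_coe_ne_zero`,
`invol_eq_self_of_mul_eq`, **`subst_trace_dvd_subst_trace_iff`**, `normForm_dvd_normForm_of_dvd`, `order_normForm`, **`coeff_zero_ne_zero_of_normForm`**,
`normForm_polynomial_eq`; §96 `order_toNat_le_of_dvd`, **`normForm_dvd_iff`**, `normForm_dvd_C_pow_mul_iff`, **`normForm_span_eq_iff`** (the two-sided squeeze and
the crux's objects follow in Part XXXIII).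

HONEST FRAMING (cell `bsd-potss`; FULL-BSD rank ≤ 1 programme, HUMAN RULING D-0036/D-0074): TOOL THEOREMS ONLY — pure commutative algebra of
`Λ = ℤ_p⟦T⟧`; no definition, no named fact, no `sorry`, axioms standard; nothing about (A), (C1⁺_η), C-cc-1 or `BSD(W,p)` of any pair is
claimed; no stub of 19606 is proved; crux and route OPEN; nothing booked. `--supports stmt-BirchSwinnertonDyer-19606`.

References: [Washington1997] §7.1 (Prop. 7.2, Thm. 7.3), §13.2; [GreenbergVatsal2000] p. 4 (after Thm. (1.2)); [GreenbergLNM1716] §1 (pp. 67–68);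
[MazurTateTeitelbaum1986Invent] §I.17. Tree: Parts XXIII–XXVII; `X1/MuLambdaAlgebra` (`mu`, `lam`, `pfree`, `red`, `eq_of_C_pow_mul_eq`);
`X1/LambdaSqueezeAlgebra` (`lam_coe_eq_natDegree`); `ChromaticIota.dvd_of_coe_dvd_coe`; Mathlib `PowerSeries.IsWeierstrassFactorization.elim`,
`Polynomial.eq_of_monic_of_associated`.
-/

set_option autoImplicit false
set_option linter.dupNamespace false
noncomputable section

open scoped Classical Topology

open PowerSeries Literature.NumberTheory.EllipticCurves Literature.NumberTheory.EllipticCurves.IwasawaAlgebra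
open Summit.BirchSwinnertonDyer.Rank1Residual.X1.MuLambda (mu lam pfree red eq_C_pow_mu_mul_pfree red_pfree_ne_zero mu_eq_and_pfree_eq
  eq_of_C_pow_mul_eq pfree_ne_zero C_pow_ne_zero mu_mul lam_mul)
open Summit.BirchSwinnertonDyer.Rank1Residual.X1.ParitySqueeze (lam_coe_eq_natDegree coe_ne_zero_of_isDistinguishedAt lam_eq_zero_of_isUnit
  lam_C_pow_mul)
open Summit.BirchSwinnertonDyer.BirchSwinnertonDyer.Theorems.ChromaticIota (dvd_of_coe_dvd_coe)

namespace Summit.BirchSwinnertonDyer.BirchSwinnertonDyer.Theorems.EtaThetaFunctionalEquation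

variable {p : ℕ} [hp : Fact p.Prime]

/-! ## §94 Weierstrass data under divisibility: `f₁ ∣ f₂ ⟺ μ₁ ≤ μ₂ ∧ P₁ ∣ P₂`; `(f₁) = (f₂) ⟺ μ₁ = μ₂ ∧ P₁ = P₂` -/

/-- `P·U ≢ 0 (mod p)` for `P` distinguished and `U ∈ Λˣ` (`P ≡ T^d`, `U(0) ∈ ℤ_pˣ`). [cite: Washington1997, §7.1] -/
theorem red_coe_mul_ne_zero {P : Polynomial ℤ_[p]} (hP : P.IsDistinguishedAt (IsLocalRing.maximalIdeal ℤ_[p])) {U : IwasawaAlgebra p}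
    (hU : IsUnit U) : red ((P : IwasawaAlgebra p) * U) ≠ 0 :=
  hP.map_ne_zero_of_eq_mul _ _ (fun hmem ↦ (IsLocalRing.mem_maximalIdeal _).mp hmem (PowerSeries.isUnit_iff_constantCoeff.mp hU)) rfl

/-- A Weierstrass datum `p^m·P·U` is nonzero. [cite: Washington1997, §7.1] -/
theorem weierstrass_ne_zero (m : ℕ) {P : Polynomial ℤ_[p]} (hP : P.IsDistinguishedAt (IsLocalRing.maximalIdeal ℤ_[p])) {U : IwasawaAlgebra p}
    (hU : IsUnit U) : C ((p : ℤ_[p]) ^ m) * (P : IwasawaAlgebra p) * U ≠ 0 := by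
  rw [mul_assoc]
  exact mul_ne_zero (C_pow_ne_zero m) fun h ↦ red_coe_mul_ne_zero hP hU (by rw [h]; exact map_zero _)

/-- **`μ` and the `p`-free part of a Weierstrass datum**: `f = p^m·P·U` ⟹ `μ(f) = m`, `pfree f = P·U` (uniqueness of `f = p^μ·f₀`).
[cite: Washington1997, §7.1 (Thm. 7.3)] -/
theorem mu_pfree_of_weierstrass {f : IwasawaAlgebra p} {m : ℕ} {P : Polynomial ℤ_[p]} (hP : P.IsDistinguishedAt (IsLocalRing.maximalIdeal ℤ_[p]))
    {U : IwasawaAlgebra p} (hU : IsUnit U) (hf : f = C ((p : ℤ_[p]) ^ m) * (P : IwasawaAlgebra p) * U) :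
    mu f = m ∧ pfree f = (P : IwasawaAlgebra p) * U :=
  mu_eq_and_pfree_eq (red_coe_mul_ne_zero hP hU) (by rw [hf, mul_assoc])

/-- **`λ` of a Weierstrass datum is the degree of its polynomial**: `f = p^m·P·U` ⟹ `λ(f) = deg P`. [cite: Washington1997, §7.1 (Thm. 7.3)] -/
theorem lam_of_weierstrass {f : IwasawaAlgebra p} {m : ℕ} {P : Polynomial ℤ_[p]} (hP : P.IsDistinguishedAt (IsLocalRing.maximalIdeal ℤ_[p]))
    {U : IwasawaAlgebra p} (hU : IsUnit U) (hf : f = C ((p : ℤ_[p]) ^ m) * (P : IwasawaAlgebra p) * U) : lam f = P.natDegree := by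
  have hP0 := coe_ne_zero_of_isDistinguishedAt hP
  rw [hf, mul_assoc, lam_C_pow_mul m (mul_ne_zero hP0 hU.ne_zero), lam_mul hP0 hU.ne_zero, lam_coe_eq_natDegree hP,
    lam_eq_zero_of_isUnit hU, add_zero]

/-- **`ord_T` of a Weierstrass datum is `ord_T` of its polynomial**: `f = p^m·P·U` ⟹ `ord_T f = ord_T P` (`p^m ≠ 0` is a constant, `U(0) ≠ 0`).
[cite: Washington1997, §7.1] -/
theorem order_of_weierstrass {f : IwasawaAlgebra p} {m : ℕ} {P : Polynomial ℤ_[p]} {U : IwasawaAlgebra p} (hU : IsUnit U)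
    (hf : f = C ((p : ℤ_[p]) ^ m) * (P : IwasawaAlgebra p) * U) :
    PowerSeries.order f = PowerSeries.order (P : IwasawaAlgebra p) := by
  have hC : PowerSeries.order (C ((p : ℤ_[p]) ^ m) : IwasawaAlgebra p) = 0 := by
    refine order_eq_nat.mpr ⟨?_, fun i hi ↦ (Nat.not_lt_zero i hi).elim⟩
    rw [coeff_zero_eq_constantCoeff, constantCoeff_C]
    exact pow_ne_zero m (Nat.cast_ne_zero.mpr hp.out.ne_zero)
  rw [hf, order_mul, order_mul, hC, order_zero_of_unit hU, zero_add, add_zero]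

/-- **THE WEIERSTRASS DATUM OF A QUOTIENT.** If `f₁ = p^{m₁}P₁U₁` divides `f₂ = p^{m₂}P₂U₂` in `Λ` (`P_i` distinguished, `U_i ∈ Λˣ`), then the
quotient is `q = p^{m_q}P_qU_q` with **`m₂ = m₁ + m_q` and `P₂ = P₁·P_q`** (uniqueness of Weierstrass preparation applied to
`p^{m₂}P₂U₂ = p^{m₁+m_q}(P₁P_q)(U₁U_q)`). [cite: Washington1997, §7.1 (Thm. 7.3)] -/
theorem exists_weierstrass_quotient_of_dvd {f₁ f₂ : IwasawaAlgebra p} {m₁ m₂ : ℕ} {P₁ P₂ : Polynomial ℤ_[p]}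
    (hP₁ : P₁.IsDistinguishedAt (IsLocalRing.maximalIdeal ℤ_[p])) (hP₂ : P₂.IsDistinguishedAt (IsLocalRing.maximalIdeal ℤ_[p]))
    {U₁ U₂ : IwasawaAlgebra p} (hU₁ : IsUnit U₁) (hU₂ : IsUnit U₂)
    (hf₁ : f₁ = C ((p : ℤ_[p]) ^ m₁) * (P₁ : IwasawaAlgebra p) * U₁) (hf₂ : f₂ = C ((p : ℤ_[p]) ^ m₂) * (P₂ : IwasawaAlgebra p) * U₂)
    (h : f₁ ∣ f₂) :
    ∃ (q : IwasawaAlgebra p) (mq : ℕ) (Pq : Polynomial ℤ_[p]) (Uq : IwasawaAlgebra p), f₂ = f₁ * q ∧ q ≠ 0 ∧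
      Pq.IsDistinguishedAt (IsLocalRing.maximalIdeal ℤ_[p]) ∧ IsUnit Uq ∧ q = C ((p : ℤ_[p]) ^ mq) * (Pq : IwasawaAlgebra p) * Uq ∧
      m₂ = m₁ + mq ∧ P₂ = P₁ * Pq ∧ U₂ = U₁ * Uq := by
  obtain ⟨q, hq⟩ := h
  have hf₂0 : f₂ ≠ 0 := hf₂ ▸ weierstrass_ne_zero m₂ hP₂ hU₂
  have hq0 : q ≠ 0 := fun h0 ↦ hf₂0 (by rw [hq, h0, mul_zero])
  obtain ⟨Pq, Uq, hPq, hUq, -, hqW⟩ := exists_weierstrass_of_ne_zero hq0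
  generalize hmq : mu q = mq at hqW
  have hprod : f₂ = C ((p : ℤ_[p]) ^ (m₁ + mq)) * ((P₁ * Pq : Polynomial ℤ_[p]) : IwasawaAlgebra p) * (U₁ * Uq) := by
    rw [hq, hf₁, hqW, pow_add, map_mul, Polynomial.coe_mul]; ring
  have hcmp := eq_of_C_pow_mul_eq (red_coe_mul_ne_zero hP₂ hU₂) (red_coe_mul_ne_zero (hP₁.mul hPq) (hU₁.mul hUq))
    (by rw [← mul_assoc, ← mul_assoc, ← hf₂, ← hprod])
  obtain ⟨hm, hPU⟩ := hcmp
  have hfac : P₂ = P₁ * Pq ∧ U₂ = U₁ * Uq :=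
    PowerSeries.IsWeierstrassFactorization.elim (g := (P₂ : IwasawaAlgebra p) * U₂) ⟨hP₂, hU₂, rfl⟩ ⟨hP₁.mul hPq, hU₁.mul hUq, hPU⟩
  exact ⟨q, mq, Pq, Uq, hq, hq0, hPq, hUq, hqW, hm, hfac.1, hfac.2⟩

/-- **DIVISIBILITY IN `Λ` READ ON WEIERSTRASS DATA: `f₁ ∣ f₂ ⟺ μ₁ ≤ μ₂ ∧ P₁ ∣ P₂` (in `ℤ_p[T]`)** for `f_i = p^{m_i}·P_i·U_i`. (`⟸`: `P₂ = P₁R`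
gives `f₂ = f₁ · p^{m₂−m₁}·R·U₂·U₁⁻¹`.) [cite: Washington1997, §7.1 (Thm. 7.3)] [cite: GreenbergVatsal2000, p. 4] -/
theorem weierstrass_dvd_iff {f₁ f₂ : IwasawaAlgebra p} {m₁ m₂ : ℕ} {P₁ P₂ : Polynomial ℤ_[p]}
    (hP₁ : P₁.IsDistinguishedAt (IsLocalRing.maximalIdeal ℤ_[p])) (hP₂ : P₂.IsDistinguishedAt (IsLocalRing.maximalIdeal ℤ_[p]))
    {U₁ U₂ : IwasawaAlgebra p} (hU₁ : IsUnit U₁) (hU₂ : IsUnit U₂)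
    (hf₁ : f₁ = C ((p : ℤ_[p]) ^ m₁) * (P₁ : IwasawaAlgebra p) * U₁) (hf₂ : f₂ = C ((p : ℤ_[p]) ^ m₂) * (P₂ : IwasawaAlgebra p) * U₂) :
    f₁ ∣ f₂ ↔ m₁ ≤ m₂ ∧ P₁ ∣ P₂ := by
  refine ⟨fun h ↦ ?_, fun ⟨hm, hP⟩ ↦ ?_⟩
  · obtain ⟨-, mq, Pq, -, -, -, -, -, -, hm, hP, -⟩ := exists_weierstrass_quotient_of_dvd hP₁ hP₂ hU₁ hU₂ hf₁ hf₂ h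
    exact ⟨hm ▸ Nat.le_add_right m₁ mq, hP ▸ dvd_mul_right P₁ Pq⟩
  · obtain ⟨R, hR⟩ := hP
    obtain ⟨d, rfl⟩ := Nat.exists_eq_add_of_le hm
    obtain ⟨V₁, hV₁⟩ := hU₁.exists_right_inv
    refine ⟨C ((p : ℤ_[p]) ^ d) * (R : IwasawaAlgebra p) * U₂ * V₁, ?_⟩
    rw [hf₂, hf₁, hR, pow_add, map_mul, Polynomial.coe_mul]
    calc C ((p : ℤ_[p]) ^ m₁) * C ((p : ℤ_[p]) ^ d) * ((P₁ : IwasawaAlgebra p) * R) * U₂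
        = C ((p : ℤ_[p]) ^ m₁) * C ((p : ℤ_[p]) ^ d) * ((P₁ : IwasawaAlgebra p) * R) * U₂ * (U₁ * V₁) := by rw [hV₁, mul_one]
      _ = C ((p : ℤ_[p]) ^ m₁) * (P₁ : IwasawaAlgebra p) * U₁ * (C ((p : ℤ_[p]) ^ d) * (R : IwasawaAlgebra p) * U₂ * V₁) := by ring

/-- **Two elements with Weierstrass data generate the same ideal only if the data agree: `(f₁) = (f₂) ⟹ m₁ = m₂ ∧ P₁ = P₂`** (mutual
divisibility; monic polynomials dividing each other are equal). [cite: Washington1997, §7.1 (Thm. 7.3)] [cite: GreenbergVatsal2000, p. 4] -/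
theorem weierstrass_eq_of_span_eq {f₁ f₂ : IwasawaAlgebra p} {m₁ m₂ : ℕ} {P₁ P₂ : Polynomial ℤ_[p]}
    (hP₁ : P₁.IsDistinguishedAt (IsLocalRing.maximalIdeal ℤ_[p])) (hP₂ : P₂.IsDistinguishedAt (IsLocalRing.maximalIdeal ℤ_[p]))
    {U₁ U₂ : IwasawaAlgebra p} (hU₁ : IsUnit U₁) (hU₂ : IsUnit U₂)
    (hf₁ : f₁ = C ((p : ℤ_[p]) ^ m₁) * (P₁ : IwasawaAlgebra p) * U₁) (hf₂ : f₂ = C ((p : ℤ_[p]) ^ m₂) * (P₂ : IwasawaAlgebra p) * U₂)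
    (h : Ideal.span {f₁} = Ideal.span {f₂}) : m₁ = m₂ ∧ P₁ = P₂ := by
  have hass : Associated f₁ f₂ := Ideal.span_singleton_eq_span_singleton.mp h
  obtain ⟨h12, h21⟩ := hass.dvd_dvd
  obtain ⟨hm12, hP12⟩ := (weierstrass_dvd_iff hP₁ hP₂ hU₁ hU₂ hf₁ hf₂).mp h12
  obtain ⟨hm21, hP21⟩ := (weierstrass_dvd_iff hP₂ hP₁ hU₂ hU₁ hf₂ hf₁).mp h21
  exact ⟨le_antisymm hm12 hm21, Polynomial.eq_of_monic_of_associated hP₁.monic hP₂.monic (associated_of_dvd_dvd hP12 hP21)⟩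

/-- **`(f₁) = (f₂) ⟺ μ₁ = μ₂ ∧ P₁ = P₂`**: two nonzero elements of `Λ` generate the same ideal iff they have the same `μ` and the same
Weierstrass polynomial. [cite: Washington1997, §7.1 (Thm. 7.3)] [cite: GreenbergVatsal2000, p. 4] -/
theorem weierstrass_span_eq_iff {f₁ f₂ : IwasawaAlgebra p} {m₁ m₂ : ℕ} {P₁ P₂ : Polynomial ℤ_[p]}
    (hP₁ : P₁.IsDistinguishedAt (IsLocalRing.maximalIdeal ℤ_[p])) (hP₂ : P₂.IsDistinguishedAt (IsLocalRing.maximalIdeal ℤ_[p]))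
    {U₁ U₂ : IwasawaAlgebra p} (hU₁ : IsUnit U₁) (hU₂ : IsUnit U₂)
    (hf₁ : f₁ = C ((p : ℤ_[p]) ^ m₁) * (P₁ : IwasawaAlgebra p) * U₁) (hf₂ : f₂ = C ((p : ℤ_[p]) ^ m₂) * (P₂ : IwasawaAlgebra p) * U₂) :
    Ideal.span {f₁} = Ideal.span {f₂} ↔ m₁ = m₂ ∧ P₁ = P₂ := by
  refine ⟨weierstrass_eq_of_span_eq hP₁ hP₂ hU₁ hU₂ hf₁ hf₂, fun ⟨hm, hP⟩ ↦ ?_⟩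
  subst hm hP
  exact Ideal.span_singleton_eq_span_singleton.mpr (associated_of_dvd_dvd
    ((weierstrass_dvd_iff hP₁ hP₁ hU₁ hU₂ hf₁ hf₂).mpr ⟨le_rfl, dvd_rfl⟩)
    ((weierstrass_dvd_iff hP₁ hP₁ hU₂ hU₁ hf₂ hf₁).mpr ⟨le_rfl, dvd_rfl⟩))

/-! ## §95 Norm forms: `H₁(Z) ∣ H₂(Z)` in `Λ` iff `H₁ ∣ H₂` in `ℤ_p[Z]`; `H(0) ≠ 0` -/

section NormCoordinate

variable {r : ℤ_[p]} {S Z : IwasawaAlgebra p}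

/-- `H(Z) ≠ 0` for `H` distinguished (`H ≠ 0` and `H ↦ H(Z)` is injective, Part XXIII). [cite: Washington1997, §7.1] -/
theorem subst_trace_coe_ne_zero (hZ : Z = X + invol p X) {H : Polynomial ℤ_[p]} (hH : H.IsDistinguishedAt (IsLocalRing.maximalIdeal ℤ_[p])) :
    (PowerSeries.subst Z (H : IwasawaAlgebra p) : IwasawaAlgebra p) ≠ 0 := fun h0 ↦
  coe_ne_zero_of_isDistinguishedAt hH (subst_trace_injective hZ (by simp only; rw [h0, ← coe_substAlgHom (hasSubst_trace hZ), map_zero]))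

/-- **The cofactor of an `ι`-invariant in an `ι`-invariant is `ι`-invariant**: `A·q = B`, `ιA = A ≠ 0`, `ιB = B` ⟹ `ιq = q` (`Λ` is a domain).
[cite: MazurTateTeitelbaum1986Invent, §I.17] -/
theorem invol_eq_self_of_mul_eq {A B q : IwasawaAlgebra p} (hA0 : A ≠ 0) (hA : invol p A = A) (hB : invol p B = B) (h : A * q = B) :
    invol p q = q := by
  have h1 : A * invol p q = A * q := by
    have := congr_arg (invol p) h
    rw [map_mul, hA, hB, ← h] at this
    exact this
  exact mul_left_cancel₀ hA0 h1

/-- **`H₁(Z) ∣ H₂(Z)` in `Λ` ⟺ `H₁ ∣ H₂` in `ℤ_p[Z]`** (`p` odd: `2r = −1`, `S = T(1+T)^r`, `Z = T + ιT`; `H₁` distinguished). The cofactor `q` is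
`ι`-invariant, so `q = G(Z)` (`Λ^ι = ℤ_p⟦Z⟧`, Part XXIII), `H₂ = H₁·G` in `Λ` (injectivity of `H ↦ H(Z)`), and a distinguished polynomial
dividing a polynomial in `Λ` divides it in `ℤ_p[T]` (`Λ/(H₁) ≅ ℤ_p[T]/(H₁)`). [cite: Washington1997, §7.1 (Prop. 7.2), §13.2]
[cite: MazurTateTeitelbaum1986Invent, §I.17] -/
theorem subst_trace_dvd_subst_trace_iff (hr : 2 * r = -1) (hS : S = X * binomialSeries ℤ_[p] r) (hZ : Z = X + invol p X)
    {H₁ : Polynomial ℤ_[p]} (hH₁ : H₁.IsDistinguishedAt (IsLocalRing.maximalIdeal ℤ_[p])) (H₂ : Polynomial ℤ_[p]) :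
    (PowerSeries.subst Z (H₁ : IwasawaAlgebra p) : IwasawaAlgebra p) ∣ PowerSeries.subst Z (H₂ : IwasawaAlgebra p) ↔ H₁ ∣ H₂ := by
  have hZ' := hasSubst_trace hZ
  refine ⟨fun ⟨q, hq⟩ ↦ ?_, fun ⟨R, hR⟩ ↦ ⟨PowerSeries.subst Z (R : IwasawaAlgebra p), by rw [hR, Polynomial.coe_mul, subst_mul hZ']⟩⟩
  have hιq : invol p q = q :=
    invol_eq_self_of_mul_eq (subst_trace_coe_ne_zero hZ hH₁) (invol_subst_trace hZ _) (invol_subst_trace hZ _) hq.symm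
  obtain ⟨G, hG⟩ := (invol_eq_self_iff_exists_subst hr hS hZ q).mp hιq
  have hΛ : (H₂ : IwasawaAlgebra p) = (H₁ : IwasawaAlgebra p) * G := by
    apply subst_trace_injective hZ
    simp only
    rw [subst_mul hZ', ← hG, hq]
  exact dvd_of_coe_dvd_coe hH₁ ⟨G, hΛ⟩

/-- If `H₁ ∣ H₂` in `ℤ_p[Z]` (`H₂ ≠ 0`) then the norm form of `H₁` divides that of `H₂` up to the displayed monomials:
`T^{r₂}(1+T)^{deg H₂}H₂(Z) = [T^{r₁}(1+T)^{deg H₁}H₁(Z)] · [T^{r₂−r₁}(1+T)^{deg G}G(Z)]`, `H₂ = H₁G`, for `r₁ ≤ r₂`. [cite: Washington1997, §7.1, §13.2] -/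
theorem normForm_dvd_normForm_of_dvd (hZ : Z = X + invol p X) {H₁ H₂ : Polynomial ℤ_[p]} (hH₂0 : H₂ ≠ 0) (h : H₁ ∣ H₂) {r₁ r₂ : ℕ}
    (hr₁₂ : r₁ ≤ r₂) :
    (X ^ r₁ * (1 + X) ^ H₁.natDegree * PowerSeries.subst Z (H₁ : IwasawaAlgebra p) : IwasawaAlgebra p) ∣
      X ^ r₂ * (1 + X) ^ H₂.natDegree * PowerSeries.subst Z (H₂ : IwasawaAlgebra p) := by
  obtain ⟨G, hG⟩ := h
  have hH₁0 : H₁ ≠ 0 := fun h0 ↦ hH₂0 (by rw [hG, h0, zero_mul])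
  have hG0 : G ≠ 0 := fun h0 ↦ hH₂0 (by rw [hG, h0, mul_zero])
  obtain ⟨d, rfl⟩ := Nat.exists_eq_add_of_le hr₁₂
  refine ⟨X ^ d * (1 + X) ^ G.natDegree * PowerSeries.subst Z (G : IwasawaAlgebra p), ?_⟩
  rw [hG, Polynomial.natDegree_mul hH₁0 hG0, Polynomial.coe_mul, subst_mul (hasSubst_trace hZ), pow_add, pow_add]
  ring

/-- `ord_T (T^r·(1+T)^k·H(Z)) = r + 2·ord H`. [cite: Washington1997, §7.1] -/
theorem order_normForm (hZ : Z = X + invol p X) (r₀ k : ℕ) (H : IwasawaAlgebra p) :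
    PowerSeries.order (X ^ r₀ * (1 + X) ^ k * PowerSeries.subst Z H : IwasawaAlgebra p) = r₀ + 2 * PowerSeries.order H := by
  have h1 : IsUnit ((1 + X : IwasawaAlgebra p) ^ k) := by
    refine IsUnit.pow k ?_
    rw [PowerSeries.isUnit_iff_constantCoeff, map_add, map_one, constantCoeff_X, add_zero]
    exact isUnit_one
  rw [order_mul, order_mul, order_zero_of_unit h1, add_zero, order_subst_trace hZ, order_pow, order_X, nsmul_one]

/-- **THE CONSTANT TERM OF A NORM FORM: `H(0) ≠ 0`** (`Z ∤ H`). If `f = p^m·P·U` with `P = T^{ord_T f}·(1+T)^k·H(Z)` (the normal form of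
Parts XXVI/XXVII, `r₀ = ord_T f`) then `ord_T H = 0`: the zero `T = 0` of `f` is carried entirely by `T^{r₀}`, and `z = 0` is never a root
of `H_an` / `H_alg`. [cite: Washington1997, §7.1 (Thm. 7.3)] -/
theorem coeff_zero_ne_zero_of_normForm (hZ : Z = X + invol p X) {f : IwasawaAlgebra p} (hf0 : f ≠ 0) {m : ℕ} {P : Polynomial ℤ_[p]}
    {U : IwasawaAlgebra p} (hU : IsUnit U) (hf : f = C ((p : ℤ_[p]) ^ m) * (P : IwasawaAlgebra p) * U) {k : ℕ} {H : Polynomial ℤ_[p]}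
    (hPH : (P : IwasawaAlgebra p) = X ^ (PowerSeries.order f).toNat * (1 + X) ^ k * PowerSeries.subst Z (H : IwasawaAlgebra p)) :
    H.coeff 0 ≠ 0 := by
  have hord := order_of_weierstrass hU hf
  rw [hPH, order_normForm hZ, ← coe_toNat_order hf0] at hord
  have h2 : 2 * PowerSeries.order (H : IwasawaAlgebra p) = 0 := by
    have h' : ((PowerSeries.order f).toNat : ℕ∞) + 2 * PowerSeries.order (H : IwasawaAlgebra p) = (PowerSeries.order f).toNat + 0 := by
      rw [add_zero]; exact hord.symm
    exact WithTop.add_left_cancel (WithTop.coe_ne_top) h'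
  have h0 : PowerSeries.order (H : IwasawaAlgebra p) = 0 := by
    rcases mul_eq_zero.mp h2 with h | h
    · exact absurd h two_ne_zero
    · exact h
  have hH0 : (H : IwasawaAlgebra p) ≠ 0 := fun h ↦ by
    rw [h, order_zero] at h0
    exact WithTop.top_ne_zero h0
  have hc := coeff_order hH0
  rw [h0] at hc
  simpa [Polynomial.coeff_coe] using hc

/-- The `Λ`-level norm form `P = T^r(1+T)^kH(Z)` is the polynomial identity `P = T^r · Σ_{i≤k} h_iT^{2i}(1+T)^{k−i}` (`k = deg H`; Part XXVI's
`coe_normPoly_eq` and injectivity of `ℤ_p[T] → Λ`). [cite: Washington1997, §7.1, §13.2] -/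
theorem normForm_polynomial_eq (hZ : Z = X + invol p X) {P H : Polynomial ℤ_[p]} {r₀ : ℕ}
    (hPH : (P : IwasawaAlgebra p) = X ^ r₀ * (1 + X) ^ H.natDegree * PowerSeries.subst Z (H : IwasawaAlgebra p)) :
    P = Polynomial.X ^ r₀ * ∑ i ∈ Finset.range (H.natDegree + 1),
      Polynomial.C (H.coeff i) * Polynomial.X ^ (2 * i) * (1 + Polynomial.X) ^ (H.natDegree - i) := by
  apply Polynomial.coe_injective
  rw [Polynomial.coe_mul, Polynomial.coe_pow, Polynomial.coe_X, coe_normPoly_eq hZ H, hPH, mul_assoc]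

/-! ## §96 Two norm forms: `f₁ ∣ f₂ ⟺ m₁ ≤ m₂ ∧ r₁ ≤ r₂ ∧ H₁ ∣ H₂`; `(f₁) = (f₂) ⟺ m₁ = m₂ ∧ r₁ = r₂ ∧ H₁ = H₂` -/

/-- `f₁ ∣ f₂ ≠ 0` ⟹ `ord_T f₁ ≤ ord_T f₂` (as natural numbers). [cite: Washington1997, §7.1] -/
theorem order_toNat_le_of_dvd {f₁ f₂ : IwasawaAlgebra p} (hf₂0 : f₂ ≠ 0) (h : f₁ ∣ f₂) :
    (PowerSeries.order f₁).toNat ≤ (PowerSeries.order f₂).toNat := by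
  obtain ⟨q, hq⟩ := h
  have hf₁0 : f₁ ≠ 0 := fun h0 ↦ hf₂0 (by rw [hq, h0, zero_mul])
  have hle : PowerSeries.order f₁ ≤ PowerSeries.order f₂ := by rw [hq, order_mul]; exact le_self_add
  exact ENat.toNat_le_toNat hle ((order_finite_iff_ne_zero.mpr hf₂0).ne)

/-- **DIVISIBILITY OF NORM FORMS: `f₁ ∣ f₂ ⟺ m₁ ≤ m₂ ∧ r₁ ≤ r₂ ∧ H₁ ∣ H₂` (in `ℤ_p[Z]`).** Here `p` is odd (`2r = −1`, `S`, `Z = T + ιT`),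
`f_i = p^{m_i}·P_i·U_i` are Weierstrass data and `P_i = T^{r_i}(1+T)^{k_i}H_i(Z)` their norm forms (`r_i = ord_T f_i`, `H_i ∈ ℤ_p[Z]` distinguished
of degree `k_i` — the output of Parts XXVI/XXVII for every `L_p^±(V, η, X)` and, granted Kim 3.11η, every generator of `Char X^ε(V/K_∞)^η`).
(`⟹`: `P₂ = P₁P_q` with `P_q = T^{r₂−r₁}·D`, cancel `T^{r₂}` in the domain `Λ`, then §95; `⟸`: §95 and §94.) So an `ι`-stable divisor is read
in the HALF-degree ring `ℤ_p[Z]`. [cite: Washington1997, §7.1 (Thm. 7.3), §13.2] [cite: GreenbergVatsal2000, p. 4] [cite: MazurTateTeitelbaum1986Invent, §I.17] -/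
theorem normForm_dvd_iff (hr : 2 * r = -1) (hS : S = X * binomialSeries ℤ_[p] r) (hZ : Z = X + invol p X)
    {f₁ f₂ : IwasawaAlgebra p} {m₁ m₂ : ℕ} {P₁ P₂ : Polynomial ℤ_[p]}
    (hP₁ : P₁.IsDistinguishedAt (IsLocalRing.maximalIdeal ℤ_[p])) (hP₂ : P₂.IsDistinguishedAt (IsLocalRing.maximalIdeal ℤ_[p]))
    {U₁ U₂ : IwasawaAlgebra p} (hU₁ : IsUnit U₁) (hU₂ : IsUnit U₂)
    (hf₁ : f₁ = C ((p : ℤ_[p]) ^ m₁) * (P₁ : IwasawaAlgebra p) * U₁) (hf₂ : f₂ = C ((p : ℤ_[p]) ^ m₂) * (P₂ : IwasawaAlgebra p) * U₂)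
    {H₁ H₂ : Polynomial ℤ_[p]} (hH₁ : H₁.IsDistinguishedAt (IsLocalRing.maximalIdeal ℤ_[p]))
    (hH₂ : H₂.IsDistinguishedAt (IsLocalRing.maximalIdeal ℤ_[p]))
    (hPH₁ : (P₁ : IwasawaAlgebra p) = X ^ (PowerSeries.order f₁).toNat * (1 + X) ^ H₁.natDegree * PowerSeries.subst Z (H₁ : IwasawaAlgebra p))
    (hPH₂ : (P₂ : IwasawaAlgebra p) = X ^ (PowerSeries.order f₂).toNat * (1 + X) ^ H₂.natDegree * PowerSeries.subst Z (H₂ : IwasawaAlgebra p)) :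
    f₁ ∣ f₂ ↔ m₁ ≤ m₂ ∧ (PowerSeries.order f₁).toNat ≤ (PowerSeries.order f₂).toNat ∧ H₁ ∣ H₂ := by
  have hZ' := hasSubst_trace hZ
  have hf₁0 : f₁ ≠ 0 := hf₁ ▸ weierstrass_ne_zero m₁ hP₁ hU₁
  have hf₂0 : f₂ ≠ 0 := hf₂ ▸ weierstrass_ne_zero m₂ hP₂ hU₂
  set r₁ := (PowerSeries.order f₁).toNat with hr₁
  set r₂ := (PowerSeries.order f₂).toNat with hr₂
  refine ⟨fun h ↦ ?_, fun ⟨hm, hr₁₂, hH⟩ ↦ ?_⟩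
  · obtain ⟨q, mq, Pq, Uq, hq, hq0, hPq, hUq, hqW, hm, hP, -⟩ := exists_weierstrass_quotient_of_dvd hP₁ hP₂ hU₁ hU₂ hf₁ hf₂ h
    refine ⟨hm ▸ Nat.le_add_right _ _, order_toNat_le_of_dvd hf₂0 h, ?_⟩
    -- `T`-orders: `r₂ = r₁ + s`, `s = ord_T q = ord_T P_q`
    set s := (PowerSeries.order q).toNat with hs
    have hsq : PowerSeries.order (Pq : IwasawaAlgebra p) = (s : ℕ∞) := by rw [← order_of_weierstrass hUq hqW, hs, coe_toNat_order hq0]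
    have hr₁₂ : r₂ = r₁ + s := by
      have h' : PowerSeries.order f₂ = PowerSeries.order f₁ + PowerSeries.order q := by rw [hq, order_mul]
      rw [← coe_toNat_order hf₂0, ← coe_toNat_order hf₁0, ← coe_toNat_order hq0] at h'
      exact_mod_cast h'
    -- `P_q = T^s · D` in `Λ`
    have hPqD : (Pq : IwasawaAlgebra p) = X ^ s * divXPowOrder (Pq : IwasawaAlgebra p) := by
      conv_lhs => rw [← X_pow_order_mul_divXPowOrder (f := (Pq : IwasawaAlgebra p)), hsq]
      rfl
    -- cancel `T^{r₂}`
    have hΛ : (X : IwasawaAlgebra p) ^ r₂ * ((1 + X) ^ H₂.natDegree * PowerSeries.subst Z (H₂ : IwasawaAlgebra p)) =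
        X ^ r₂ * ((1 + X) ^ H₁.natDegree * PowerSeries.subst Z (H₁ : IwasawaAlgebra p) * divXPowOrder (Pq : IwasawaAlgebra p)) := by
      have e := congr_arg (fun P : Polynomial ℤ_[p] ↦ (P : IwasawaAlgebra p)) hP
      simp only [Polynomial.coe_mul] at e
      rw [hPH₂, hPH₁, hPqD, hr₁₂] at e
      rw [hr₁₂]
      linear_combination e
    have hcancel := mul_left_cancel₀ (pow_ne_zero r₂ (X_ne_zero (R := ℤ_[p]))) hΛ
    have h1u : IsUnit ((1 + X : IwasawaAlgebra p) ^ H₂.natDegree) := by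
      refine IsUnit.pow _ ?_
      rw [PowerSeries.isUnit_iff_constantCoeff, map_add, map_one, constantCoeff_X, add_zero]; exact isUnit_one
    obtain ⟨W, hW⟩ := h1u.exists_left_inv
    have hdvd : (PowerSeries.subst Z (H₁ : IwasawaAlgebra p) : IwasawaAlgebra p) ∣ PowerSeries.subst Z (H₂ : IwasawaAlgebra p) := by
      refine ⟨W * (1 + X) ^ H₁.natDegree * divXPowOrder (Pq : IwasawaAlgebra p), ?_⟩
      calc PowerSeries.subst Z (H₂ : IwasawaAlgebra p)
          = W * (1 + X) ^ H₂.natDegree * PowerSeries.subst Z (H₂ : IwasawaAlgebra p) := by rw [hW, one_mul]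
        _ = W * ((1 + X) ^ H₂.natDegree * PowerSeries.subst Z (H₂ : IwasawaAlgebra p)) := by rw [mul_assoc]
        _ = _ := by rw [hcancel]; ring
    exact (subst_trace_dvd_subst_trace_iff hr hS hZ hH₁ H₂).mp hdvd
  · have hPdvd : (P₁ : IwasawaAlgebra p) ∣ (P₂ : IwasawaAlgebra p) := by
      rw [hPH₁, hPH₂]; exact normForm_dvd_normForm_of_dvd hZ hH₂.monic.ne_zero hH hr₁₂
    exact (weierstrass_dvd_iff hP₁ hP₂ hU₁ hU₂ hf₁ hf₂).mpr ⟨hm, dvd_of_coe_dvd_coe hP₁ hPdvd⟩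

/-- **With a `p`-power: `f₁ ∣ pⁿ·f₂ ⟺ m₁ ≤ m₂ + n ∧ r₁ ≤ r₂ ∧ H₁ ∣ H₂`** (the datum of `pⁿf₂` is `(m₂ + n, P₂, U₂)`; `ord_T(pⁿf₂) = ord_T f₂`) — the shape
of Kobayashi's Thm. 4.1 `pⁿ·L ∈ Char`. [cite: Washington1997, §7.1 (Thm. 7.3)] [cite: Kobayashi2003, Thm. 4.1 (p. 8)] -/
theorem normForm_dvd_C_pow_mul_iff (hr : 2 * r = -1) (hS : S = X * binomialSeries ℤ_[p] r) (hZ : Z = X + invol p X)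
    {f₁ f₂ : IwasawaAlgebra p} {m₁ m₂ : ℕ} {P₁ P₂ : Polynomial ℤ_[p]}
    (hP₁ : P₁.IsDistinguishedAt (IsLocalRing.maximalIdeal ℤ_[p])) (hP₂ : P₂.IsDistinguishedAt (IsLocalRing.maximalIdeal ℤ_[p]))
    {U₁ U₂ : IwasawaAlgebra p} (hU₁ : IsUnit U₁) (hU₂ : IsUnit U₂)
    (hf₁ : f₁ = C ((p : ℤ_[p]) ^ m₁) * (P₁ : IwasawaAlgebra p) * U₁) (hf₂ : f₂ = C ((p : ℤ_[p]) ^ m₂) * (P₂ : IwasawaAlgebra p) * U₂)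
    {H₁ H₂ : Polynomial ℤ_[p]} (hH₁ : H₁.IsDistinguishedAt (IsLocalRing.maximalIdeal ℤ_[p]))
    (hH₂ : H₂.IsDistinguishedAt (IsLocalRing.maximalIdeal ℤ_[p]))
    (hPH₁ : (P₁ : IwasawaAlgebra p) = X ^ (PowerSeries.order f₁).toNat * (1 + X) ^ H₁.natDegree * PowerSeries.subst Z (H₁ : IwasawaAlgebra p))
    (hPH₂ : (P₂ : IwasawaAlgebra p) = X ^ (PowerSeries.order f₂).toNat * (1 + X) ^ H₂.natDegree * PowerSeries.subst Z (H₂ : IwasawaAlgebra p))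
    (n : ℕ) :
    f₁ ∣ C ((p : ℤ_[p]) ^ n) * f₂ ↔ m₁ ≤ m₂ + n ∧ (PowerSeries.order f₁).toNat ≤ (PowerSeries.order f₂).toNat ∧ H₁ ∣ H₂ := by
  have hf₂' : C ((p : ℤ_[p]) ^ n) * f₂ = C ((p : ℤ_[p]) ^ (m₂ + n)) * (P₂ : IwasawaAlgebra p) * U₂ := by
    rw [hf₂, pow_add, map_mul]; ring
  have hord : PowerSeries.order (C ((p : ℤ_[p]) ^ n) * f₂) = PowerSeries.order f₂ := by
    rw [order_of_weierstrass hU₂ hf₂', order_of_weierstrass hU₂ hf₂]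
  have h := normForm_dvd_iff hr hS hZ hP₁ hP₂ hU₁ hU₂ hf₁ hf₂' hH₁ hH₂ hPH₁ (by rw [hord]; exact hPH₂)
  rw [hord] at h
  exact h

/-- **EQUALITY OF IDEALS OF NORM FORMS: `(f₁) = (f₂) ⟺ m₁ = m₂ ∧ r₁ = r₂ ∧ H₁ = H₂`** — two `ι`-stable principal ideals coincide iff their
`μ`, their order at `T = 0` and their norm polynomials `H ∈ ℤ_p[Z]` coincide: the main conjecture at a row of the crux as THREE equalities
(`μ_an = μ_alg`, `r₀,an = r₀,alg`, `H_an = H_alg`). [cite: Washington1997, §7.1 (Thm. 7.3), §13.2] [cite: GreenbergVatsal2000, p. 4 (after Thm. (1.2))] -/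
theorem normForm_span_eq_iff (hr : 2 * r = -1) (hS : S = X * binomialSeries ℤ_[p] r) (hZ : Z = X + invol p X)
    {f₁ f₂ : IwasawaAlgebra p} {m₁ m₂ : ℕ} {P₁ P₂ : Polynomial ℤ_[p]}
    (hP₁ : P₁.IsDistinguishedAt (IsLocalRing.maximalIdeal ℤ_[p])) (hP₂ : P₂.IsDistinguishedAt (IsLocalRing.maximalIdeal ℤ_[p]))
    {U₁ U₂ : IwasawaAlgebra p} (hU₁ : IsUnit U₁) (hU₂ : IsUnit U₂)
    (hf₁ : f₁ = C ((p : ℤ_[p]) ^ m₁) * (P₁ : IwasawaAlgebra p) * U₁) (hf₂ : f₂ = C ((p : ℤ_[p]) ^ m₂) * (P₂ : IwasawaAlgebra p) * U₂)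
    {H₁ H₂ : Polynomial ℤ_[p]} (hH₁ : H₁.IsDistinguishedAt (IsLocalRing.maximalIdeal ℤ_[p]))
    (hH₂ : H₂.IsDistinguishedAt (IsLocalRing.maximalIdeal ℤ_[p]))
    (hPH₁ : (P₁ : IwasawaAlgebra p) = X ^ (PowerSeries.order f₁).toNat * (1 + X) ^ H₁.natDegree * PowerSeries.subst Z (H₁ : IwasawaAlgebra p))
    (hPH₂ : (P₂ : IwasawaAlgebra p) = X ^ (PowerSeries.order f₂).toNat * (1 + X) ^ H₂.natDegree * PowerSeries.subst Z (H₂ : IwasawaAlgebra p)) :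
    Ideal.span {f₁} = Ideal.span {f₂} ↔
      m₁ = m₂ ∧ (PowerSeries.order f₁).toNat = (PowerSeries.order f₂).toNat ∧ H₁ = H₂ := by
  rw [Ideal.span_singleton_eq_span_singleton]
  refine ⟨fun hass ↦ ?_, fun ⟨hm, hr₁₂, hH⟩ ↦ ?_⟩
  · obtain ⟨h12, h21⟩ := hass.dvd_dvd
    obtain ⟨hm12, hr12, hH12⟩ := (normForm_dvd_iff hr hS hZ hP₁ hP₂ hU₁ hU₂ hf₁ hf₂ hH₁ hH₂ hPH₁ hPH₂).mp h12
    obtain ⟨hm21, hr21, hH21⟩ := (normForm_dvd_iff hr hS hZ hP₂ hP₁ hU₂ hU₁ hf₂ hf₁ hH₂ hH₁ hPH₂ hPH₁).mp h21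
    exact ⟨le_antisymm hm12 hm21, le_antisymm hr12 hr21,
      Polynomial.eq_of_monic_of_associated hH₁.monic hH₂.monic (associated_of_dvd_dvd hH12 hH21)⟩
  · exact associated_of_dvd_dvd
      ((normForm_dvd_iff hr hS hZ hP₁ hP₂ hU₁ hU₂ hf₁ hf₂ hH₁ hH₂ hPH₁ hPH₂).mpr ⟨hm.le, hr₁₂.le, hH ▸ dvd_rfl⟩)
      ((normForm_dvd_iff hr hS hZ hP₂ hP₁ hU₂ hU₁ hf₂ hf₁ hH₂ hH₁ hPH₂ hPH₁).mpr ⟨hm.ge, hr₁₂.ge, hH ▸ dvd_rfl⟩)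

end NormCoordinate

end Summit.BirchSwinnertonDyer.BirchSwinnertonDyer.Theorems.EtaThetaFunctionalEquation

end
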